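import Summits.QuantumAdvantage.AdviceFreeQNC0.CrossTeamEmbedding
import Summits.QuantumAdvantage.AdviceFreeQNC0.CrossToProduct
import HarnessLib

/-!
# Cell qa-qnc0 (rung F-Q1, route RingFrame, crux α `RingToElim`): the TRANSVERSAL 3×3 RECTANGLE
# PARITY OBSTRUCTION for the cross-team referee (degree-free, every charge)

The cross-team game (`CrossTeam.lean`, planner qa-qnc0-p2 line `tensor` / qa-qnc0-p1 line `product`):
team 0 holds `u ∈ {0,1}^L` and an `𝔽₄`-valued profile `F₀ u v`, team 1 holds `v ∈ {0,1}^{L'}` and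
`F₁ v u`; the cell `(u, v)` is WON iff `Tr(ω^{c+|u|+|v|}(F₀ u v + ω^{|u|} F₁ v u)) = 1`
(`crossWin`, `win_iff`).  Every walk strategy on `L + L'` bits IS such a pair of profiles
(`ringWinU_append`, `CrossTeamEmbedding.lean`).

* `crossWin_eq_xor` — the referee in SPLIT TRACE FORM:
  `crossWin c F₀ F₁ u v = Tr(ω^{c+|u|+|v|} F₀ u v) ⊕ Tr(ω^{c+2|u|+|v|} F₁ v u)`.
* `crossWin_rectangle_xor` — **the parity obstruction.**  Take rows `u₀, u₁, u₂` with
  `|u_i| ≡ i (mod 3)` and columns `v₀, v₁, v₂` with `|v_j| ≡ j` (a TRANSVERSAL rectangle), and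
  suppose team 0's profile is constant along each row of the rectangle (`F₀ (u i) (v j) = α i`) and
  team 1's along each column (`F₁ (v j) (u i) = β j`).  Then the XOR of the nine win bits is `0`:
  row `i` contributes `Tr(α_i ω^{c+i} (1 + ω + ω²)) = 0`, column `j` contributes
  `Tr(β_j ω^{c+j} (1 + ω² + ω⁴)) = 0`.  Hence (`crossWin_rectangle_exists_loss`) **at least one of the
  nine cells is LOST** — for EVERY pair of profiles, with no degree hypothesis at all.
* `ringWinU_rectangle_exists_fail` — the walk-game form: for every walk strategy `y` on `L + L'`
  bits and every transversal rectangle on which the two block profiles `F0 y`, `F1 y` are row- resp.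
  column-constant, one of the nine inputs `u_i ++ v_j` is a failure.
* `card_goodRectangles_le` (`_fail`) — the counting form: `#{good rectangles} ≤ 9 · 4^L · 4^{L'} · #FAIL`
  (a good rectangle is charged to a lost cell; a cell lies on `≤ 4^L·4^{L'}` rectangles at each of
  the nine positions), i.e. the FAILURE DENSITY of any walk strategy is at least one ninth of the
  DENSITY OF GOOD RECTANGLES among all `(u⃗, v⃗) ∈ ({0,1}^L)³ × ({0,1}^{L'})³`.

Why this matters (memo PROVER3-MEMO-gen7 §2): the degree enters only in LOWER-BOUNDING the density of
good rectangles.  At cross-degree `0` (cross-free strategies) every transversal rectangle is good; in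
the Viola–Wigderson regime `4^D ≪ n` joint level sets of `≤ 6` degree-`D` selectors are
residue-equidistributed (`LevelSetResidueBalance.lean`), which is the proposed route to a positive
good-rectangle density and hence to the aside `RingHardLogDeg` (stmt-QuantumAdvantage-19453) beyond
the `log n / log log n` ceiling of Theorem V (`WalkHardLogOverLogLog.lean`).

WHAT THIS IS NOT: no lower bound on the number of good rectangles is proved here (that is the open
combinatorial step); nothing at polylog degree; α untouched; separation NOT moved.  The cell's
statement (prover qn-prover-3 gen 7, 2026-08-27); the 3×3 parity idea is the cell's
(`CellParityObstruction.lean`, `CrossCellObstruction.lean`, there for cross-free windows via 2-D robust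
Hegedűs); not in print.
-/

namespace Summit.QuantumAdvantage.AdviceFreeQNC0

open Finset Literature.Computability.MetaComplexity Literature.Computability.MetaComplexity.Smolensky

variable {L L' : ℕ}

/-! ### The referee in split trace form -/

/-- The trace (second coordinate) is additive. -/
theorem snd_t4add (p q : T4) : (t4add p q).2 = xor p.2 q.2 := rfl

/-- **Split trace form of the referee**:
`crossWin c F₀ F₁ u v = Tr(ω^{c+|u|+|v|} F₀ u v) ⊕ Tr(ω^{c+2|u|+|v|} F₁ v u)`. -/
theorem crossWin_eq_xor (c : ℕ) (F₀ : (Fin L → Bool) → (Fin L' → Bool) → T4)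
    (F₁ : (Fin L' → Bool) → (Fin L → Bool) → T4) (u : Fin L → Bool) (v : Fin L' → Bool) :
    crossWin c F₀ F₁ u v =
      xor (tOmegaPow (c + wt u + wt v) (F₀ u v)).2 (tOmegaPow (c + 2 * wt u + wt v) (F₁ v u)).2 := by
  have h : crossWin c F₀ F₁ u v =
      (tOmegaPow (c + wt u + wt v) (t4add (F₀ u v) (tOmegaPow (wt u) (F₁ v u)))).2 := by
    unfold crossWin
    rw [Bool.eq_iff_iff, decide_eq_true_eq, win_iff]
  rw [h, tOmegaPow_t4add, snd_t4add, ← tOmegaPow_add]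
  have he : c + wt u + wt v + wt u = c + 2 * wt u + wt v := by ring
  rw [he]

/-! ### `1 + ω + ω² = 0` -/

/-- `Tr(ω^m p) ⊕ Tr(ω^{m+1} p) ⊕ Tr(ω^{m+2} p) = 0` for every `p ∈ 𝔽₄` (`1 + ω + ω² = 0`). -/
theorem tOmegaPow_snd_three (m : ℕ) (p : T4) :
    xor (tOmegaPow m p).2 (xor (tOmegaPow (m + 1) p).2 (tOmegaPow (m + 2) p).2) = false := by
  rw [tOmegaPow_mod m, tOmegaPow_mod (m + 1), tOmegaPow_mod (m + 2)]
  have h1 : (m + 1) % 3 = (m % 3 + 1) % 3 := by omega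
  have h2 : (m + 2) % 3 = (m % 3 + 2) % 3 := by omega
  rw [h1, h2]
  have hm : m % 3 < 3 := Nat.mod_lt _ (by norm_num)
  generalize m % 3 = r at hm ⊢
  obtain ⟨a, b⟩ := p
  interval_cases r <;> cases a <;> cases b <;> decide

/-! ### The parity obstruction on a transversal rectangle -/

/-- The residue-level statement: for `c' < 3` and any six elements of `𝔽₄`, the nine bits
`Tr(ω^{c'+i+j} α_i) ⊕ Tr(ω^{c'+2i+j} β_j)` (`i, j < 3`) XOR to `0`.  (Finite check.) -/
private theorem rectangle_residues :
    ∀ c' : Fin 3, ∀ α₀ α₁ α₂ β₀ β₁ β₂ : T4,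
      (xor (xor (tOmegaPow (c'.val + 0 + 0) α₀).2 (tOmegaPow (c'.val + 2 * 0 + 0) β₀).2)
      (xor (xor (tOmegaPow (c'.val + 0 + 1) α₀).2 (tOmegaPow (c'.val + 2 * 0 + 1) β₁).2)
      (xor (xor (tOmegaPow (c'.val + 0 + 2) α₀).2 (tOmegaPow (c'.val + 2 * 0 + 2) β₂).2)
      (xor (xor (tOmegaPow (c'.val + 1 + 0) α₁).2 (tOmegaPow (c'.val + 2 * 1 + 0) β₀).2)
      (xor (xor (tOmegaPow (c'.val + 1 + 1) α₁).2 (tOmegaPow (c'.val + 2 * 1 + 1) β₁).2)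
      (xor (xor (tOmegaPow (c'.val + 1 + 2) α₁).2 (tOmegaPow (c'.val + 2 * 1 + 2) β₂).2)
      (xor (xor (tOmegaPow (c'.val + 2 + 0) α₂).2 (tOmegaPow (c'.val + 2 * 2 + 0) β₀).2)
      (xor (xor (tOmegaPow (c'.val + 2 + 1) α₂).2 (tOmegaPow (c'.val + 2 * 2 + 1) β₁).2)
           (xor (tOmegaPow (c'.val + 2 + 2) α₂).2 (tOmegaPow (c'.val + 2 * 2 + 2) β₂).2))))))))) =
        false := by
  unfold tOmegaPow
  decide

/-- Exponents only matter modulo `3`, in the shape used below. -/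
private theorem tOmegaPow_congr_mod {m m' : ℕ} (h : m % 3 = m' % 3) (p : T4) :
    tOmegaPow m p = tOmegaPow m' p := by
  rw [tOmegaPow_mod m, tOmegaPow_mod m', h]

/-- **The transversal 3×3 rectangle parity obstruction (XOR form).**  Rows `u i` with
`|u i| ≡ i`, columns `v j` with `|v j| ≡ j (mod 3)`; team 0's profile row-constant on the rectangle
(`F₀ (u i) (v j) = α i`) and team 1's column-constant (`F₁ (v j) (u i) = β j`).  Then the XOR of the
nine win bits `crossWin c F₀ F₁ (u i) (v j)` is `false`. -/
theorem crossWin_rectangle_xor (c : ℕ) (F₀ : (Fin L → Bool) → (Fin L' → Bool) → T4)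
    (F₁ : (Fin L' → Bool) → (Fin L → Bool) → T4) (u : Fin 3 → (Fin L → Bool))
    (v : Fin 3 → (Fin L' → Bool)) (hu : ∀ i, wt (u i) % 3 = i.val) (hv : ∀ j, wt (v j) % 3 = j.val)
    (α β : Fin 3 → T4) (hα : ∀ i j, F₀ (u i) (v j) = α i) (hβ : ∀ i j, F₁ (v j) (u i) = β j) :
    (xor (crossWin c F₀ F₁ (u 0) (v 0)) (xor (crossWin c F₀ F₁ (u 0) (v 1))
      (xor (crossWin c F₀ F₁ (u 0) (v 2)) (xor (crossWin c F₀ F₁ (u 1) (v 0))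
      (xor (crossWin c F₀ F₁ (u 1) (v 1)) (xor (crossWin c F₀ F₁ (u 1) (v 2))
      (xor (crossWin c F₀ F₁ (u 2) (v 0)) (xor (crossWin c F₀ F₁ (u 2) (v 1))
        (crossWin c F₀ F₁ (u 2) (v 2)))))))))) = false := by
  simp only [crossWin_eq_xor, hα, hβ]
  have key := rectangle_residues ⟨c % 3, Nat.mod_lt _ (by norm_num)⟩ (α 0) (α 1) (α 2) (β 0) (β 1) (β 2)
  simp only at key
  have hu0 := hu 0; have hu1 := hu 1; have hu2 := hu 2
  have hv0 := hv 0; have hv1 := hv 1; have hv2 := hv 2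
  simp only [Fin.val_zero, Fin.val_one, Fin.val_two] at hu0 hu1 hu2 hv0 hv1 hv2
  have e0 : ∀ i j : Fin 3, (c + wt (u i) + wt (v j)) % 3 = (c % 3 + i.val + j.val) % 3 := by
    intro i j; have := hu i; have := hv j; omega
  have e1 : ∀ i j : Fin 3, (c + 2 * wt (u i) + wt (v j)) % 3 = (c % 3 + 2 * i.val + j.val) % 3 := by
    intro i j; have := hu i; have := hv j; omega
  rw [tOmegaPow_congr_mod (e0 0 0), tOmegaPow_congr_mod (e0 0 1), tOmegaPow_congr_mod (e0 0 2),
    tOmegaPow_congr_mod (e0 1 0), tOmegaPow_congr_mod (e0 1 1), tOmegaPow_congr_mod (e0 1 2),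
    tOmegaPow_congr_mod (e0 2 0), tOmegaPow_congr_mod (e0 2 1), tOmegaPow_congr_mod (e0 2 2),
    tOmegaPow_congr_mod (e1 0 0), tOmegaPow_congr_mod (e1 0 1), tOmegaPow_congr_mod (e1 0 2),
    tOmegaPow_congr_mod (e1 1 0), tOmegaPow_congr_mod (e1 1 1), tOmegaPow_congr_mod (e1 1 2),
    tOmegaPow_congr_mod (e1 2 0), tOmegaPow_congr_mod (e1 2 1), tOmegaPow_congr_mod (e1 2 2)]
  simpa using key

/-- Nine Booleans whose XOR is `false` are not all `true`. -/
private theorem not_all_of_xor9 (b₀ b₁ b₂ b₃ b₄ b₅ b₆ b₇ b₈ : Bool)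
    (h : xor b₀ (xor b₁ (xor b₂ (xor b₃ (xor b₄ (xor b₅ (xor b₆ (xor b₇ b₈))))))) = false) :
    b₀ = false ∨ b₁ = false ∨ b₂ = false ∨ b₃ = false ∨ b₄ = false ∨ b₅ = false ∨ b₆ = false ∨
      b₇ = false ∨ b₈ = false := by
  cases b₀ <;> cases b₁ <;> cases b₂ <;> cases b₃ <;> cases b₄ <;> cases b₅ <;> cases b₆ <;> cases b₇ <;>
    cases b₈ <;> simp_all

/-- **At least one of the nine cells of a good transversal rectangle is LOST** (every charge, every
pair of profiles, no degree hypothesis). -/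
theorem crossWin_rectangle_exists_loss (c : ℕ) (F₀ : (Fin L → Bool) → (Fin L' → Bool) → T4)
    (F₁ : (Fin L' → Bool) → (Fin L → Bool) → T4) (u : Fin 3 → (Fin L → Bool))
    (v : Fin 3 → (Fin L' → Bool)) (hu : ∀ i, wt (u i) % 3 = i.val) (hv : ∀ j, wt (v j) % 3 = j.val)
    (α β : Fin 3 → T4) (hα : ∀ i j, F₀ (u i) (v j) = α i) (hβ : ∀ i j, F₁ (v j) (u i) = β j) :
    ∃ i j : Fin 3, crossWin c F₀ F₁ (u i) (v j) = false := by
  have h := not_all_of_xor9 _ _ _ _ _ _ _ _ _ (crossWin_rectangle_xor c F₀ F₁ u v hu hv α β hα hβ)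
  rcases h with h | h | h | h | h | h | h | h | h
  exacts [⟨0, 0, h⟩, ⟨0, 1, h⟩, ⟨0, 2, h⟩, ⟨1, 0, h⟩, ⟨1, 1, h⟩, ⟨1, 2, h⟩, ⟨2, 0, h⟩, ⟨2, 1, h⟩,
    ⟨2, 2, h⟩]

/-! ### The walk-game form -/

/-- **Walk-game form.**  For every charge-`c` walk strategy `y` on `L + L'` bits and every
transversal rectangle (`|u i| ≡ i`, `|v j| ≡ j`) on which the block profiles are row- resp.
column-constant (`F0 y (u i) (v j) = α i`, `F1 y (v j) (u i) = β j`), one of the nine inputs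
`u i ++ v j` is a FAILURE of `y`. -/
theorem ringWinU_rectangle_exists_fail (c : ℕ) (y : Fin (L + L' + 1) → (Fin (L + L') → Bool) → Bool)
    (u : Fin 3 → (Fin L → Bool)) (v : Fin 3 → (Fin L' → Bool))
    (hu : ∀ i, wt (u i) % 3 = i.val) (hv : ∀ j, wt (v j) % 3 = j.val) (α β : Fin 3 → T4)
    (hα : ∀ i j, F0 y (u i) (v j) = α i) (hβ : ∀ i j, F1 y (v j) (u i) = β j) :
    ∃ i j : Fin 3, ringWinU c y (Fin.append (u i) (v j)) = false := by
  obtain ⟨i, j, h⟩ := crossWin_rectangle_exists_loss c (F0 y) (F1 y) u v hu hv α β hα hβ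
  exact ⟨i, j, by rw [ringWinU_append]; exact h⟩

/-! ### The counting form -/

/-! The GOOD transversal rectangles of a pair of profiles are the pairs `R = (u⃗, v⃗)`,
`u⃗ : Fin 3 → {0,1}^L`, `v⃗ : Fin 3 → {0,1}^{L'}`, with `|u i| ≡ i`, `|v j| ≡ j`, team 0's profile
constant along each row of the rectangle and team 1's along each column; they are written as an
explicit `Finset.filter` below (no new definition enters the cell's vocabulary). -/

/-- Summing a function of ONE coordinate over all `Fin 3 → X`: `Σ_f g (f i) = |X|² · Σ_x g x`. -/
private theorem sum_pi_coord {X : Type*} [Fintype X] [DecidableEq X] (i : Fin 3) (g : X → ℕ) :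
    ∑ f : Fin 3 → X, g (f i) = Fintype.card X ^ 2 * ∑ x : X, g x := by
  classical
  have h := Finset.prod_univ_sum (fun _ : Fin 3 => (univ : Finset X))
    (fun k x => if k = i then g x else 1)
  rw [Fintype.piFinset_univ] at h
  have hl : (∏ k : Fin 3, ∑ x : X, (if k = i then g x else 1 : ℕ)) = Fintype.card X ^ 2 * ∑ x : X, g x := by
    have hk : ∀ k : Fin 3, (∑ x : X, (if k = i then g x else 1 : ℕ)) =
        if k = i then ∑ x : X, g x else Fintype.card X := by
      intro k; split_ifs <;> simp
    simp_rw [hk]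
    rw [Finset.prod_ite, Finset.prod_const, Finset.prod_const]
    have h1 : (univ.filter fun k : Fin 3 => k = i).card = 1 := by
      rw [Finset.filter_eq', if_pos (mem_univ i), card_singleton]
    have h2 : (univ.filter fun k : Fin 3 => ¬ k = i).card = 2 := by
      have := Finset.card_filter_add_card_filter_not (s := (univ : Finset (Fin 3))) (fun k => k = i)
      rw [h1, card_univ, Fintype.card_fin] at this; omega
    rw [h1, h2, pow_one, mul_comm]
  have hr : (∑ f : Fin 3 → X, ∏ k : Fin 3, (if k = i then g (f k) else 1 : ℕ)) = ∑ f : Fin 3 → X, g (f i) := by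
    refine Finset.sum_congr rfl fun f _ => ?_
    rw [Finset.prod_eq_single i (fun k _ hk => if_neg hk) (fun h => absurd (mem_univ i) h), if_pos rfl]
  rw [← hr, ← h, hl]

/-- Cells at a fixed position: the number of pairs `(f, g)` of triples whose `(i, j)` cell lies in
a set `S` is `4^L · 4^{L'} · #S`. -/
private theorem card_filter_cell (i j : Fin 3) (S : Finset ((Fin L → Bool) × (Fin L' → Bool))) :
    ((univ : Finset ((Fin 3 → (Fin L → Bool)) × (Fin 3 → (Fin L' → Bool)))).filter
        fun R => (R.1 i, R.2 j) ∈ S).card = 4 ^ L * 4 ^ L' * S.card := by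
  classical
  rw [card_filter, Fintype.sum_prod_type]
  have h1 : ∀ f : Fin 3 → (Fin L → Bool),
      (∑ g : Fin 3 → (Fin L' → Bool), (if ((f, g).1 i, (f, g).2 j) ∈ S then 1 else 0 : ℕ)) =
        Fintype.card (Fin L' → Bool) ^ 2 *
          ∑ y : Fin L' → Bool, (if (f i, y) ∈ S then 1 else 0 : ℕ) := by
    intro f
    exact sum_pi_coord j (fun y => if (f i, y) ∈ S then 1 else 0)
  simp_rw [h1]
  rw [← mul_sum, sum_pi_coord i (fun x => ∑ y : Fin L' → Bool, (if (x, y) ∈ S then 1 else 0 : ℕ)),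
    ← Fintype.sum_prod_type (f := fun p : (Fin L → Bool) × (Fin L' → Bool) => (if p ∈ S then 1 else 0 : ℕ)),
    ← card_filter, filter_mem_eq_inter, univ_inter, Fintype.card_fun, Fintype.card_fun,
    Fintype.card_bool, Fintype.card_fin, Fintype.card_fin]
  have e1 : ((2 : ℕ) ^ L') ^ 2 = 4 ^ L' := by rw [← pow_mul, mul_comm, pow_mul]; norm_num
  have e2 : ((2 : ℕ) ^ L) ^ 2 = 4 ^ L := by rw [← pow_mul, mul_comm, pow_mul]; norm_num
  rw [e1, e2]; ring

/-- **Counting form of the obstruction**: every good rectangle has a lost cell, and a cell sits on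
at most `4^L·4^{L'}` rectangles at each of the nine positions, so
`#{good rectangles} ≤ 9 · 4^L · 4^{L'} · #{lost cells}`.  Equivalently: the loss density of ANY
pair of profiles is at least one ninth of its good-rectangle density. -/
theorem card_goodRectangles_le (c : ℕ) (F₀ : (Fin L → Bool) → (Fin L' → Bool) → T4)
    (F₁ : (Fin L' → Bool) → (Fin L → Bool) → T4) :
    ((univ : Finset ((Fin 3 → (Fin L → Bool)) × (Fin 3 → (Fin L' → Bool)))).filter fun R =>
        (∀ i, wt (R.1 i) % 3 = i.val) ∧ (∀ j, wt (R.2 j) % 3 = j.val) ∧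
          (∀ i j, F₀ (R.1 i) (R.2 j) = F₀ (R.1 i) (R.2 0)) ∧
            (∀ i j, F₁ (R.2 j) (R.1 i) = F₁ (R.2 j) (R.1 0))).card ≤
      9 * (4 ^ L * 4 ^ L' *
        ((univ : Finset ((Fin L → Bool) × (Fin L' → Bool))).filter
          fun p => crossWin c F₀ F₁ p.1 p.2 = false).card) := by
  classical
  set lost := (univ : Finset ((Fin L → Bool) × (Fin L' → Bool))).filter
    fun p => crossWin c F₀ F₁ p.1 p.2 = false with hlost
  -- every good rectangle has a lost cell at some position `(i, j)`
  have hcover : ((univ : Finset ((Fin 3 → (Fin L → Bool)) × (Fin 3 → (Fin L' → Bool)))).filter fun R =>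
        (∀ i, wt (R.1 i) % 3 = i.val) ∧ (∀ j, wt (R.2 j) % 3 = j.val) ∧
          (∀ i j, F₀ (R.1 i) (R.2 j) = F₀ (R.1 i) (R.2 0)) ∧
            (∀ i j, F₁ (R.2 j) (R.1 i) = F₁ (R.2 j) (R.1 0))) ⊆
      (univ : Finset (Fin 3 × Fin 3)).biUnion fun ij =>
        (univ : Finset ((Fin 3 → (Fin L → Bool)) × (Fin 3 → (Fin L' → Bool)))).filter
          fun R => (R.1 ij.1, R.2 ij.2) ∈ lost := by
    intro R hR
    rw [mem_filter] at hR
    obtain ⟨_, hu, hv, hrow, hcol⟩ := hR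
    obtain ⟨i, j, hij⟩ := crossWin_rectangle_exists_loss c F₀ F₁ R.1 R.2 hu hv
      (fun i => F₀ (R.1 i) (R.2 0)) (fun j => F₁ (R.2 j) (R.1 0)) hrow hcol
    rw [mem_biUnion]
    refine ⟨(i, j), mem_univ _, ?_⟩
    rw [mem_filter]
    refine ⟨mem_univ _, ?_⟩
    rw [hlost, mem_filter]
    exact ⟨mem_univ _, hij⟩
  refine (card_le_card hcover).trans (card_biUnion_le.trans ?_)
  rw [Finset.sum_congr rfl fun ij _ => card_filter_cell ij.1 ij.2 lost, sum_const,
    card_univ, Fintype.card_prod, Fintype.card_fin, smul_eq_mul]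

/-- **Walk-game counting form**: for every charge-`c` walk strategy `y` on `L + L'` bits,
`#{good rectangles of (F0 y, F1 y)} ≤ 9 · 4^L · 4^{L'} · #{w : y fails on w}`. -/
theorem card_goodRectangles_le_fail (c : ℕ) (y : Fin (L + L' + 1) → (Fin (L + L') → Bool) → Bool) :
    ((univ : Finset ((Fin 3 → (Fin L → Bool)) × (Fin 3 → (Fin L' → Bool)))).filter fun R =>
        (∀ i, wt (R.1 i) % 3 = i.val) ∧ (∀ j, wt (R.2 j) % 3 = j.val) ∧
          (∀ i j, F0 y (R.1 i) (R.2 j) = F0 y (R.1 i) (R.2 0)) ∧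
            (∀ i j, F1 y (R.2 j) (R.1 i) = F1 y (R.2 j) (R.1 0))).card ≤
      9 * (4 ^ L * 4 ^ L' * (univ.filter fun w : Fin (L + L') → Bool => ringWinU c y w = false).card) := by
  refine (card_goodRectangles_le c (F0 y) (F1 y)).trans (Nat.mul_le_mul_left _ (Nat.mul_le_mul_left _ ?_))
  -- lost cells ↦ failing inputs, injectively via `Fin.append`
  have hinj : Function.Injective fun p : (Fin L → Bool) × (Fin L' → Bool) => Fin.append p.1 p.2 := by
    intro p q h
    have h1 : p.1 = q.1 := by
      funext i
      have := congrFun h (Fin.castAdd L' i)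
      simpa [Fin.append_left] using this
    have h2 : p.2 = q.2 := by
      funext i
      have := congrFun h (Fin.natAdd L i)
      simpa [Fin.append_right] using this
    exact Prod.ext h1 h2
  rw [← card_image_of_injective _ hinj]
  refine card_le_card fun w hw => ?_
  rw [mem_image] at hw
  obtain ⟨p, hp, rfl⟩ := hw
  rw [mem_filter] at hp ⊢
  exact ⟨mem_univ _, by rw [ringWinU_append]; exact hp.2⟩

end Summit.QuantumAdvantage.AdviceFreeQNC0
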